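import Mathlib.Geometry.Manifold.MFDeriv.Basic
import HarnessLib

/-!
# The inclusion of an open submanifold has identity differential

For an open subset `U : TopologicalSpace.Opens M` of a charted space `M` (model with corners `I`
on `(E, H)`), Mathlib endows `U` with the open-submanifold structure whose charts are the
restricted charts of `M` (`TopologicalSpace.Opens.instChartedSpace`), and the tangent spaces agree
definitionally, `TangentSpace I x = E = TangentSpace I ↑x`. This file records that the inclusion
`Subtype.val : U → M` has the identity as manifold derivative (Lee, *Introduction to Smooth
Manifolds*, 2nd ed. (2013), Example 1.26 and Prop. 3.9: `T_p U = T_p M`; O'Neill 1983, Ch. 1,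
pp. 3 and 7):

* `OpenSubmanifold.hasMFDerivAt_subtype_val` — `HasMFDerivAt I I Subtype.val x (id)`;
* `OpenSubmanifold.mfderiv_subtype_val` — `mfderiv I I Subtype.val x = id`;
* `OpenSubmanifold.mdifferentiableAt_subtype_val`.

These are general manifold facts. They were first proved inside
`Literature/Topology/FourManifolds/OrientedConnectedSumSphereSelf.lean` (as
`Literature.Topology.FourManifolds.hasMFDerivAt_subtype_val` etc.), which forced
`Literature/Geometry/Riemannian/Necks.lean` to import the whole connected-sum tower for one lemma
(review of p10602, promote event 131699); this Mathlib-only file is their canonical home, the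
statements and proofs are moved verbatim, and the old names become deprecated aliases.
The companion file `OpenSubmanifoldTangent.lean` (same namespace) compares the local
trivialisations of `TU` and `TM`; nothing here depends on it.

Mathlib has the smoothness of the inclusion (`contMDiff_subtype_val`,
`TopologicalSpace.Opens.chartAt_subtype_val_symm_eventuallyEq`) but not this derivative
computation (`rg "mfderiv.*subtype_val|Subtype.val.*mfderiv" Mathlib/Geometry/Manifold`: no hit).

## References

* J. M. Lee, *Introduction to Smooth Manifolds*, 2nd ed., GTM 218 (2013), Example 1.26, Prop. 3.9.
* B. O'Neill, *Semi-Riemannian Geometry* (1983), Ch. 1, pp. 3, 7.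
-/

open scoped Manifold ContDiff Topology
open Set Function Filter

noncomputable section

namespace Literature.Geometry.Manifold

namespace OpenSubmanifold

variable {E H : Type*} [NormedAddCommGroup E] [NormedSpace ℝ E] [TopologicalSpace H]
  {I : ModelWithCorners ℝ E H} {M : Type*} [TopologicalSpace M] [ChartedSpace H M]
  {U : TopologicalSpace.Opens M}

/-- **The inclusion of an open submanifold has identity differential**: in the preferred charts
(the chart of `U` at `x` being the restricted chart of `M` at `↑x`) the inclusion `U → M` reads as
the identity near the base point (Lee, *Introduction to Smooth Manifolds* (2013), Example 1.26,
Prop. 3.9: `T_p U = T_p M`). [folklore] -/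
theorem hasMFDerivAt_subtype_val (x : U) :
    HasMFDerivAt I I (Subtype.val : U → M) x (ContinuousLinearMap.id ℝ E) := by
  refine ⟨continuous_subtype_val.continuousAt, ?_⟩
  have h1 := TopologicalSpace.Opens.chartAt_subtype_val_symm_eventuallyEq (H := H) U (x := x)
  have h2 : ContinuousAt I.symm ((extChartAt I x) x) := I.continuous_symm.continuousAt
  have h3 : I.symm ((extChartAt I x) x) = chartAt H (x : M) x := by
    simp only [extChartAt_coe, Function.comp_apply, ModelWithCorners.left_inv]
    rfl
  rw [ContinuousAt, h3] at h2
  have hA : ∀ᶠ z in 𝓝 ((extChartAt I x) x),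
      (((extChartAt I x).symm z : U) : M) = (extChartAt I (x : M)).symm z := by
    filter_upwards [h2.eventually h1] with z hz
    simp only [Function.comp_apply, TopologicalSpace.Opens.chartAt_eq] at hz
    simp only [extChartAt_coe_symm, Function.comp_apply, TopologicalSpace.Opens.chartAt_eq]
    exact hz.symm
  have hB : ∀ᶠ z in 𝓝[range I] ((extChartAt I x) x), z ∈ (extChartAt I (x : M)).target :=
    extChartAt_target_mem_nhdsWithin (x : M)
  have heq : writtenInExtChartAt I I x (Subtype.val : U → M) =ᶠ[𝓝[range I] ((extChartAt I x) x)]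
      id := by
    filter_upwards [hA.filter_mono nhdsWithin_le_nhds, hB] with z hz hz'
    simp only [writtenInExtChartAt, Function.comp_apply, id_eq]
    rw [hz]
    exact (extChartAt I (x : M)).right_inv hz'
  refine (hasFDerivWithinAt_id _ _).congr_of_eventuallyEq heq ?_
  simp only [writtenInExtChartAt, Function.comp_apply, extChartAt_to_inv, id_eq]
  rfl

/-- The differential of the inclusion of an open submanifold is the identity. [folklore] -/
theorem mfderiv_subtype_val (x : U) :
    mfderiv I I (Subtype.val : U → M) x = ContinuousLinearMap.id ℝ E :=
  (hasMFDerivAt_subtype_val x).mfderiv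

/-- The inclusion of an open submanifold is differentiable. [folklore] -/
theorem mdifferentiableAt_subtype_val (x : U) :
    MDifferentiableAt I I (Subtype.val : U → M) x :=
  (hasMFDerivAt_subtype_val x).mdifferentiableAt

end OpenSubmanifold

end Literature.Geometry.Manifold
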